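import Summits.QuantumFields.YangMills.Theorems.F4SubCurvatureDoorNullConePointedness
import Mathlib
import HarnessLib

/-!
# Route `F4SubCurvatureDoor`, crux ⟨stmt-QuantumFields-23125⟩ `RationalToGeneral`: LINE g18-A v5 «top-channel cone cut» (planner
# `ym-idea-3` g18, tree skeleton `Cruxes/RationalToGeneral/Lines/sextic_channel.lean` commit 9dfcf5fb94f6) — registered stub
# `stub_nullConePointedness` BY NAME AND SIGNATURE

The name-keyed statements of the skeleton (`E3`, `nullEval`, `laplacian`, `IsHarmonicPoly`, `NullConePointedness`) copied VERBATIM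
into this file's own namespace (pattern of `F4SubCurvatureDoorMirrorAnalyticityRegistered`), and the registered stub
`theorem stub_nullConePointedness : NullConePointedness` proved by projection from the spelled-out, def-free tree theorem
`F4SubCurvatureDoorNullCone.eq_zero_of_laplacian_eq_zero_of_aeval_nullMomentum_eq_zero` (p692527: division by the null form,
`MvPolynomial.funext`, and the tree's Fischer decomposition `disjoint_harmonic_span`; the homogeneity hypothesis is not used).

Mathlib + tree only; no `sorry`; standard axioms.  HONEST FRAMING: support stub «null-cone pointedness» (M, algebra) of an OPEN line;
the wall T1″ (`AnalyticFiniteType`), `LaplaceFourier`, `FischerNormalForm`, `ChannelShellForm`, `ConeFatouEndgame`, C3, crux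
23125 / 23035, rung R2d (`BalabanLadder.ROT`) and the summit are untouched; the Yang–Mills mass gap is NOT proved.  Width seat
`ym-line-sfw-p2-w3` g34 (cell ym-idea-1, free hands). [cite: GoodmanWallachGTM255, §5.1.2 Lemma 5.1.5]
-/

set_option autoImplicit false

noncomputable section

namespace Summit.QuantumFields.YangMills.Theorems.F4SubCurvatureDoorNullConePointednessRegistered

open scoped BigOperators

/-- Euclidean `ℝ³` (space) (verbatim from the skeleton). -/
abbrev E3 := EuclideanSpace ℝ (Fin 3)

/-- Complex evaluation of a real polynomial on `ℝ⁴` at the forward null momentum `(i‖q⃗‖, q⃗)` (`p·p = 0`)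
(verbatim from the skeleton). -/
def nullEval (P : MvPolynomial (Fin 4) ℝ) (q : E3) : ℂ :=
  MvPolynomial.aeval (Fin.cons (Complex.I * (‖q‖ : ℂ)) (fun j : Fin 3 => ((q j : ℝ) : ℂ))) P

/-- The polynomial Laplacian `Δ = Σᵢ ∂ᵢ²` on `ℝ[x₀, x₁, x₂, x₃]` (verbatim from the skeleton). -/
def laplacian (P : MvPolynomial (Fin 4) ℝ) : MvPolynomial (Fin 4) ℝ :=
  ∑ i : Fin 4, MvPolynomial.pderiv i (MvPolynomial.pderiv i P)

/-- `P` is a harmonic polynomial: `ΔP = 0` (verbatim from the skeleton). -/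
def IsHarmonicPoly (P : MvPolynomial (Fin 4) ℝ) : Prop :=
  laplacian P = 0

/-- Stub «NULL-CONE POINTEDNESS» (verbatim from the skeleton): a real harmonic homogeneous polynomial on `ℝ⁴` that vanishes at
every forward null momentum `(i‖q⃗‖, q⃗)`, `q⃗ ∈ ℝ³`, is zero. -/
def NullConePointedness : Prop :=
  ∀ (L : ℕ) (P : MvPolynomial (Fin 4) ℝ), P.IsHomogeneous L → IsHarmonicPoly P →
    (∀ q : E3, nullEval P q = 0) → P = 0

/-- **Registered stub of LINE g18-A v5, BY NAME AND SIGNATURE**: `NullConePointedness` holds — projection from the def-free tree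
theorem `F4SubCurvatureDoorNullCone.eq_zero_of_laplacian_eq_zero_of_aeval_nullMomentum_eq_zero` (the homogeneity binder is
discarded). [cite: GoodmanWallachGTM255, §5.1.2 Lemma 5.1.5] -/
theorem stub_nullConePointedness : NullConePointedness :=
  fun _L P _hhom hharm hnull =>
    Summit.QuantumFields.YangMills.Theorems.F4SubCurvatureDoorNullCone.eq_zero_of_laplacian_eq_zero_of_aeval_nullMomentum_eq_zero
      P hharm hnull

end Summit.QuantumFields.YangMills.Theorems.F4SubCurvatureDoorNullConePointednessRegistered

end
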